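import Summits.HodgeConjecture.CorCM.MultiFieldWeilSimpleFamiliesCurveFree
import HarnessLib

/-!
# MULTI-FIELD WEIL ENGINE — SIMPLE FAMILIES, STANDALONE FORM: an imaginary quadratic field `k`, a family `K : Fin r → Type` of CM fields containing `k`,
# simple CM threefolds ∕ Weil-type CM fivefolds `T : Fin r → AbelianVariety ℂ` over them — the Hodge conjecture for every product of copies, given ONLY
# Markman's theorems (no engine indexing, no curve, no type hypothesis on the threefolds)

Cell `pub-hodgecm2` (COR-CM), seat b30 gen 33 (2026-08-24); count-neutral own lane MULTI-FIELD WEIL ENGINE (stem `MultiFieldWeil*`), the reader's form of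
`CorCM/MultiFieldWeilSimpleFamiliesCurveFree.lean`.  Theorems only; no definition, no named fact, no `sorry`.  HONEST FRAMING: conditional on the displayed Markman
binders only; `HC_CM` is NOT proved and not asserted.

WHY.  The engine indexes its fields by one family `Kf : I → Type` containing the quadratic field as a member `Kf i₀` and the CM fields of the varieties as
`Kf (is m)`; that is the right currency for the census files but not for a reader, who holds an imaginary quadratic field `k`, fields `K_0, …, K_{r−1}` with
embeddings `i_m : k → K_m`, and varieties `T_0, …, T_{r−1}`.  This file instantiates the curve-free headlines at `Kf := Fin.cons k K`, `i₀ := 0`, `is := Fin.succ`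
(the instance families are `Fin.cases` of the given instances; all identifications are definitional), so that the statements below mention nothing but `k`, the
`K_m`, the `i_m`, the realisations of the `T_m`, `IsSimple` ∕ the `k`-signature, one embedding `τ` of `k` and one family `s_m ⊃ τ` of embeddings with the tower
condition.

* §1 **`hodgeConjectureFor_biproduct_simpleThreefolds_of_cubicTower`** (+ dominated) — `r` SIMPLE CM threefolds over sextic `K_m ⊇ i_m(k)`, each `K_m` with no
  `k`-embedding into `ℚ(τk) · s_0(K_0) ⋯ s_{m−1}(K_{m−1})`: the Hodge conjecture for every `⨁_j T (κ j)`, GIVEN ONLY `Markman2025_weilClasses_algebraic_abelianFourfold`.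
* §2 **`hodgeConjectureFor_biproduct_weilFivefolds_of_quinticTower`** (+ dominated) — `r` fivefolds over decic `K_m ⊇ i_m(k)` of `k`-signature `(2,3)`/`(3,2)` in a
  quintic tower, GIVEN ONLY `Markman2025_weilClasses_algebraic_hyperbolicSixfold`.
* §3 **`hodgeConjectureFor_biproduct_simpleThreefolds_weilFivefolds_of_towers`** (+ dominated) — both together (`[K_m : ℚ] = 2 n_m`, `n_m ∈ {3, 5}`), each field
  avoiding the compositum of the earlier fields of the same degree, GIVEN ONLY the two Markman theorems.

[cite: Markman2025SurveySecant, Thm. 1.2] [cite: Markman2025SecantWeil, Thm 1.5.1] [cite: Shimura1998, §6.2 Thm. 3, §8.2 Prop. 26, §8.4, §18.2 Lemma (i)]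
[cite: Lang2002, VI §1 Thm. 1.1, Cor. 1.6 and V §2 Thm. 2.8]

## References
* [Markman2025SurveySecant] E. Markman, arXiv:2509.23403, Thm. 1.2.  [Markman2025SecantWeil] E. Markman, arXiv:2502.03415, Thm 1.5.1.  [Shimura1998] G. Shimura,
  *Abelian varieties with complex multiplication and modular functions*, §6.2 Thm. 3, §8.2 Prop. 26, §8.4, §18.2 Lemma (i).  [Lang2002] S. Lang, *Algebra*,
  GTM 211, V §2, VI §1.
-/

noncomputable section

open CategoryTheory CategoryTheory.Limits NumberField IntermediateField

namespace Summit.HodgeConjecture.CorCM.MultiFieldWeil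

open Finset
open Literature.AlgebraicGeometry Literature.AlgebraicGeometry.Motives Literature.AlgebraicGeometry.HodgeTheory
open Literature.AlgebraicGeometry.ComplexMultiplication (IsCMTypeRealisation)
open Literature.AlgebraicTopology.SingularHomology
open Literature.NumberTheory.ComplexMultiplication

open scoped Classical

section Standalone

variable {r : ℕ} {k : Type} [fk : Field k] [nk : NumberField k] [ck : IsCMField k] {K : Fin r → Type} [fK : ∀ m, Field (K m)]
  [nK : ∀ m, NumberField (K m)] [cK : ∀ m, IsCMField (K m)] {T : Fin r → AbelianVariety ℂ} {Φ : ∀ m : Fin r, CMType (K m)}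
  {ι : ∀ m, 𝓞 (K m) →+* End (T m)} {θ : ∀ m, K m →+* Module.End ℂ (complexBetti (T m).X 1)}

/-! ## §1 Simple CM threefolds over a cubic tower of sextic fields containing `k` -/

/-- **SIMPLE CM THREEFOLDS WHOSE SEXTIC CM FIELDS CONTAIN ONE IMAGINARY QUADRATIC FIELD `k` AND FORM A CUBIC TOWER — given ONLY Markman's fourfold theorem.**
`k` imaginary quadratic; `K_0, …, K_{r−1}` sextic CM fields with `i_m : k → K_m`; `T_m ⊨ (K_m; Φ_m)` SIMPLE abelian threefolds (realisations read on `H¹`; nothing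
assumed on the types); `τ` an embedding of `k` and `s_m ⊃ τ` embeddings of the `K_m` such that for every `m` NO embedding of `K_m` over `τ` takes its values in
`ℚ(τk) · s_0(K_0) ⋯ s_{m−1}(K_{m−1})` (for `r = 2`: `Hom(K_1, K_0) = ∅`).  Then for every `κ : Fin N → Fin r` the Hodge conjecture holds for `⨁_j T (κ j)` — EVERY
`T_0^{b_0} × ⋯ × T_{r−1}^{b_{r−1}}` — GIVEN ONLY `Markman2025_weilClasses_algebraic_abelianFourfold`
(`hodgeConjectureFor_biproduct_comp_of_simpleThreefolds_of_cubicTower_curveFree` at `Kf = Fin.cons k K`).  `HC_CM` is NOT asserted. [cite: Markman2025SurveySecant, Thm. 1.2]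
[cite: Shimura1998, §6.2 Thm. 3, §8.2 Prop. 26, §8.4, §18.2 Lemma (i)] [cite: Lang2002, VI §1 Thm. 1.1, Cor. 1.6 and V §2 Thm. 2.8] -/
theorem hodgeConjectureFor_biproduct_simpleThreefolds_of_cubicTower (hW4 : Markman2025_weilClasses_algebraic_abelianFourfold)
    {N : ℕ} (κ : Fin N → Fin r) (h2 : Module.finrank ℚ k = 2) (h6 : ∀ m, Module.finrank ℚ (K m) = 6) (i : ∀ m, k →+* K m)
    (hT : ∀ m, IsCMTypeRealisation (Φ m) (T m) (ι m) (θ m)) (hS : ∀ m, (T m).IsSimple)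
    (τ : k →+* ℂ) (s : ∀ m, K m →+* ℂ) (hs : ∀ m, (s m).comp (i m) = τ)
    (htower : ∀ (m : Fin r) (φ : K m →+* ℂ), φ.comp (i m) = τ →
      ¬ Set.range φ ⊆ (↑(adjoin ℚ (Set.range τ) ⊔ adjoin ℚ (⋃ j : {j : Fin r // j < m}, Set.range (s j.1))) : Set ℂ)) :
    HodgeConjectureFor (⨁ fun j => T (κ j)).dim (⨁ fun j => T (κ j)).X := by
  let Kf : Fin (r + 1) → Type := Fin.cons k K
  letI instF : ∀ j, Field (Kf j) := Fin.cases fk fun m => fK m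
  letI instN : ∀ j, NumberField (Kf j) := Fin.cases nk fun m => nK m
  haveI instC : ∀ j, IsCMField (Kf j) := Fin.cases ck fun m => cK m
  exact @hodgeConjectureFor_biproduct_comp_of_simpleThreefolds_of_cubicTower_curveFree (Fin (r + 1)) r Kf instF instN instC 0 Fin.succ T Φ ι θ
    hW4 N κ h2 h6 i hT hS τ s hs htower

/-- **Dominated form**: everything dominated by a product of copies of the `T_m`. [cite: Markman2025SurveySecant, Thm. 1.2] [cite: MumfordAV1970, §19 Thm. 1 and p. 169] -/
theorem hodgeConjectureFor_of_avDominatedBy_simpleThreefolds_of_cubicTower (hW4 : Markman2025_weilClasses_algebraic_abelianFourfold)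
    {N : ℕ} (κ : Fin N → Fin r) (h2 : Module.finrank ℚ k = 2) (h6 : ∀ m, Module.finrank ℚ (K m) = 6) (i : ∀ m, k →+* K m)
    (hT : ∀ m, IsCMTypeRealisation (Φ m) (T m) (ι m) (θ m)) (hS : ∀ m, (T m).IsSimple)
    (τ : k →+* ℂ) (s : ∀ m, K m →+* ℂ) (hs : ∀ m, (s m).comp (i m) = τ)
    (htower : ∀ (m : Fin r) (φ : K m →+* ℂ), φ.comp (i m) = τ →
      ¬ Set.range φ ⊆ (↑(adjoin ℚ (Set.range τ) ⊔ adjoin ℚ (⋃ j : {j : Fin r // j < m}, Set.range (s j.1))) : Set ℂ))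
    {X : AbelianVariety ℂ} (hX : Domination.AVDominatedBy X (⨁ fun j => T (κ j))) : HodgeConjectureFor X.dim X.X :=
  Domination.hodgeConjectureFor_of_avDominatedBy (hodgeConjectureFor_biproduct_simpleThreefolds_of_cubicTower hW4 κ h2 h6 i hT hS τ s hs htower) hX

/-! ## §2 Weil-type CM fivefolds over a quintic tower of decic fields containing `k` -/

/-- **WEIL-TYPE CM FIVEFOLDS WHOSE DECIC CM FIELDS CONTAIN ONE IMAGINARY QUADRATIC FIELD `k` AND FORM A QUINTIC TOWER — given ONLY Markman's hyperbolic-sixfold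
theorem.**  `k` imaginary quadratic; `K_0, …, K_{r−1}` decic CM fields with `i_m : k → K_m`; `T_m ⊨ (K_m; Φ_m)` abelian fivefolds whose types have TWO OR THREE
members over `τ` (`k`-signature `(2,3)`/`(3,2)`: Weil type); embeddings `s_m ⊃ τ` with the quintic tower condition.  Then for every `κ : Fin N → Fin r` the Hodge
conjecture holds for `⨁_j T (κ j)`, GIVEN ONLY `Markman2025_weilClasses_algebraic_hyperbolicSixfold`.  The `(1,4)`-fivefolds are NOT covered.  `HC_CM` is NOT
asserted. [cite: Markman2025SecantWeil, Thm 1.5.1] [cite: Shimura1998, §6.2 Thm. 3, §18.2 Lemma (i)] [cite: Lang2002, VI §1 Thm. 1.1, Cor. 1.6 and V §2 Thm. 2.8] -/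
theorem hodgeConjectureFor_biproduct_weilFivefolds_of_quinticTower (hM6 : Markman2025_weilClasses_algebraic_hyperbolicSixfold)
    {N : ℕ} (κ : Fin N → Fin r) (h2 : Module.finrank ℚ k = 2) (h10 : ∀ m, Module.finrank ℚ (K m) = 10) (i : ∀ m, k →+* K m)
    (hT : ∀ m, IsCMTypeRealisation (Φ m) (T m) (ι m) (θ m)) (τ : k →+* ℂ)
    (h23 : ∀ m, (Finset.univ.filter fun s : K m →+* ℂ => s.comp (i m) = τ ∧ s ∈ (Φ m).1).card = 2 ∨
      (Finset.univ.filter fun s : K m →+* ℂ => s.comp (i m) = τ ∧ s ∈ (Φ m).1).card = 3)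
    (s : ∀ m, K m →+* ℂ) (hs : ∀ m, (s m).comp (i m) = τ)
    (htower : ∀ (m : Fin r) (φ : K m →+* ℂ), φ.comp (i m) = τ →
      ¬ Set.range φ ⊆ (↑(adjoin ℚ (Set.range τ) ⊔ adjoin ℚ (⋃ j : {j : Fin r // j < m}, Set.range (s j.1))) : Set ℂ)) :
    HodgeConjectureFor (⨁ fun j => T (κ j)).dim (⨁ fun j => T (κ j)).X := by
  let Kf : Fin (r + 1) → Type := Fin.cons k K
  letI instF : ∀ j, Field (Kf j) := Fin.cases fk fun m => fK m
  letI instN : ∀ j, NumberField (Kf j) := Fin.cases nk fun m => nK m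
  haveI instC : ∀ j, IsCMField (Kf j) := Fin.cases ck fun m => cK m
  exact @hodgeConjectureFor_biproduct_comp_of_weilFivefolds_of_quinticTower_curveFree (Fin (r + 1)) r Kf instF instN instC 0 Fin.succ T Φ ι θ
    hM6 N κ h2 h10 i hT τ h23 s hs htower

/-- **Dominated form** of `hodgeConjectureFor_biproduct_weilFivefolds_of_quinticTower`. [cite: Markman2025SecantWeil, Thm 1.5.1] [cite: MumfordAV1970, §19 Thm. 1 and p. 169] -/
theorem hodgeConjectureFor_of_avDominatedBy_weilFivefolds_of_quinticTower (hM6 : Markman2025_weilClasses_algebraic_hyperbolicSixfold)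
    {N : ℕ} (κ : Fin N → Fin r) (h2 : Module.finrank ℚ k = 2) (h10 : ∀ m, Module.finrank ℚ (K m) = 10) (i : ∀ m, k →+* K m)
    (hT : ∀ m, IsCMTypeRealisation (Φ m) (T m) (ι m) (θ m)) (τ : k →+* ℂ)
    (h23 : ∀ m, (Finset.univ.filter fun s : K m →+* ℂ => s.comp (i m) = τ ∧ s ∈ (Φ m).1).card = 2 ∨
      (Finset.univ.filter fun s : K m →+* ℂ => s.comp (i m) = τ ∧ s ∈ (Φ m).1).card = 3)
    (s : ∀ m, K m →+* ℂ) (hs : ∀ m, (s m).comp (i m) = τ)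
    (htower : ∀ (m : Fin r) (φ : K m →+* ℂ), φ.comp (i m) = τ →
      ¬ Set.range φ ⊆ (↑(adjoin ℚ (Set.range τ) ⊔ adjoin ℚ (⋃ j : {j : Fin r // j < m}, Set.range (s j.1))) : Set ℂ))
    {X : AbelianVariety ℂ} (hX : Domination.AVDominatedBy X (⨁ fun j => T (κ j))) : HodgeConjectureFor X.dim X.X :=
  Domination.hodgeConjectureFor_of_avDominatedBy (hodgeConjectureFor_biproduct_weilFivefolds_of_quinticTower hM6 κ h2 h10 i hT τ h23 s hs htower) hX

/-! ## §3 Simple threefolds and Weil-type fivefolds together -/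

/-- **SIMPLE CM THREEFOLDS AND WEIL-TYPE CM FIVEFOLDS WHOSE CM FIELDS CONTAIN ONE IMAGINARY QUADRATIC FIELD `k` — given ONLY Markman's two theorems.**
`k` imaginary quadratic; `K_0, …, K_{r−1}` CM fields with `i_m : k → K_m` and `[K_m : ℚ] = 2 n_m`, `n_m ∈ {3, 5}`; `T_m ⊨ (K_m; Φ_m)` is, when `n_m = 3`, a SIMPLE
abelian threefold and, when `n_m = 5`, a fivefold whose type has two or three members over `τ`; embeddings `s_m ⊃ τ` such that for every `m` NO embedding of
`K_m` over `τ` has image inside `ℚ(τk) · ∏_{j < m, n_j = n_m} s_j(K_j)`.  Then for every `κ : Fin N → Fin r` the Hodge conjecture holds for `⨁_j T (κ j)` —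
every `∏ T_m^{b_m}` — GIVEN ONLY `Markman2025_weilClasses_algebraic_abelianFourfold` and `Markman2025_weilClasses_algebraic_hyperbolicSixfold`.  `HC_CM` is NOT
asserted. [cite: Markman2025SurveySecant, Thm. 1.2] [cite: Markman2025SecantWeil, Thm 1.5.1] [cite: Shimura1998, §6.2 Thm. 3, §8.2 Prop. 26, §8.4, §18.2 Lemma (i)]
[cite: Lang2002, VI §1 Thm. 1.1, Cor. 1.6 and V §2 Thm. 2.8] -/
theorem hodgeConjectureFor_biproduct_simpleThreefolds_weilFivefolds_of_towers (hW4 : Markman2025_weilClasses_algebraic_abelianFourfold)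
    (hM6 : Markman2025_weilClasses_algebraic_hyperbolicSixfold) (n : Fin r → ℕ) (hn : ∀ m, n m = 3 ∨ n m = 5)
    {N : ℕ} (κ : Fin N → Fin r) (h2 : Module.finrank ℚ k = 2) (hdeg : ∀ m, Module.finrank ℚ (K m) = 2 * n m) (i : ∀ m, k →+* K m)
    (hT : ∀ m, IsCMTypeRealisation (Φ m) (T m) (ι m) (θ m)) (τ : k →+* ℂ) (hS : ∀ m, n m = 3 → (T m).IsSimple)
    (h23 : ∀ m, n m = 5 → (Finset.univ.filter fun s : K m →+* ℂ => s.comp (i m) = τ ∧ s ∈ (Φ m).1).card = 2 ∨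
      (Finset.univ.filter fun s : K m →+* ℂ => s.comp (i m) = τ ∧ s ∈ (Φ m).1).card = 3)
    (s : ∀ m, K m →+* ℂ) (hs : ∀ m, (s m).comp (i m) = τ)
    (htower : ∀ (m : Fin r) (φ : K m →+* ℂ), φ.comp (i m) = τ →
      ¬ Set.range φ ⊆ (↑(adjoin ℚ (Set.range τ) ⊔
        adjoin ℚ (⋃ j ∈ (Finset.univ.filter fun j : Fin r => n j = n m).filter (· < m), Set.range (s j))) : Set ℂ)) :
    HodgeConjectureFor (⨁ fun j => T (κ j)).dim (⨁ fun j => T (κ j)).X := by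
  let Kf : Fin (r + 1) → Type := Fin.cons k K
  letI instF : ∀ j, Field (Kf j) := Fin.cases fk fun m => fK m
  letI instN : ∀ j, NumberField (Kf j) := Fin.cases nk fun m => nK m
  haveI instC : ∀ j, IsCMField (Kf j) := Fin.cases ck fun m => cK m
  exact @hodgeConjectureFor_biproduct_comp_of_simpleThreefolds_weilFivefolds_of_towers_curveFree (Fin (r + 1)) r Kf instF instN instC 0 Fin.succ T Φ ι θ
    hW4 hM6 n hn N κ h2 hdeg i hT τ hS h23 s hs htower

/-- **Dominated form** of `hodgeConjectureFor_biproduct_simpleThreefolds_weilFivefolds_of_towers`. [cite: Markman2025SurveySecant, Thm. 1.2]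
[cite: Markman2025SecantWeil, Thm 1.5.1] [cite: MumfordAV1970, §19 Thm. 1 and p. 169] -/
theorem hodgeConjectureFor_of_avDominatedBy_simpleThreefolds_weilFivefolds_of_towers (hW4 : Markman2025_weilClasses_algebraic_abelianFourfold)
    (hM6 : Markman2025_weilClasses_algebraic_hyperbolicSixfold) (n : Fin r → ℕ) (hn : ∀ m, n m = 3 ∨ n m = 5)
    {N : ℕ} (κ : Fin N → Fin r) (h2 : Module.finrank ℚ k = 2) (hdeg : ∀ m, Module.finrank ℚ (K m) = 2 * n m) (i : ∀ m, k →+* K m)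
    (hT : ∀ m, IsCMTypeRealisation (Φ m) (T m) (ι m) (θ m)) (τ : k →+* ℂ) (hS : ∀ m, n m = 3 → (T m).IsSimple)
    (h23 : ∀ m, n m = 5 → (Finset.univ.filter fun s : K m →+* ℂ => s.comp (i m) = τ ∧ s ∈ (Φ m).1).card = 2 ∨
      (Finset.univ.filter fun s : K m →+* ℂ => s.comp (i m) = τ ∧ s ∈ (Φ m).1).card = 3)
    (s : ∀ m, K m →+* ℂ) (hs : ∀ m, (s m).comp (i m) = τ)
    (htower : ∀ (m : Fin r) (φ : K m →+* ℂ), φ.comp (i m) = τ →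
      ¬ Set.range φ ⊆ (↑(adjoin ℚ (Set.range τ) ⊔
        adjoin ℚ (⋃ j ∈ (Finset.univ.filter fun j : Fin r => n j = n m).filter (· < m), Set.range (s j))) : Set ℂ))
    {X : AbelianVariety ℂ} (hX : Domination.AVDominatedBy X (⨁ fun j => T (κ j))) : HodgeConjectureFor X.dim X.X :=
  Domination.hodgeConjectureFor_of_avDominatedBy
    (hodgeConjectureFor_biproduct_simpleThreefolds_weilFivefolds_of_towers hW4 hM6 n hn κ h2 hdeg i hT τ hS h23 s hs htower) hX

end Standalone

end Summit.HodgeConjecture.CorCM.MultiFieldWeil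

end
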